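import Literature.Computability.Complexity.Randomized
import HarnessLib

/-!
# Complexity meta: the `k`-wise direct product generator `DP_k` (Hirahara 2021, Def. 3.9–3.10)

Topic `Literature/Computability/MetaComplexity`, companion to `LanguageCompression.lean` (Def. 2.5,
Def. 4.1, Lemma 5.1, Thm. 4.2, Thm. 5.2) and `SearchHeuristicSchemes.lean` (the named fact
`Hirahara2021_UP_searchUHS_of_Avg1P` = Thm. 8.9 for `UP`-type verifiers) for S. Hirahara,
*Average-case hardness of NP from exponential worst-case hardness assumptions*, STOC 2021, full
version ECCC TR21-058 (numbering cited). It fixes the vocabulary of §3.3 used by the solver of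
Thm. 8.9 and by Thm. 3.12 (reconstruction for `DP_k`) — definitions and their API only, no named
facts:

* Def. 3.9 / Def. 3.10 — the Hadamard code `hadBit x z = Had(x)(z) = Σ xᵢzᵢ mod 2` and the
  **`k`-wise direct product generator**
  `dpGen k x z = DP_k(x; z₁,…,z_k) := (z₁,…,z_k, Had(x)(z₁),…,Had(x)(z_k))`, `z` read in `k` blocks of
  length `|x|`; API: length, the seed is a prefix (`take_length_dpGen`), the code bits are the suffix
  (`drop_length_dpGen`), injectivity in the seed. `hadBit` and the code part of `dpGen` are
  *definitionally* the tree's Goldreich–Levin predicate `ipBit` and bits `glBits k |x| x z`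
  (`Cryptography/GoldreichLevinHiding.lean`, with the `FP` implementation `glFn` in
  `Cryptography/LiuPassLemma53Programs.lean`); they are restated here (same bodies, bridge by `rfl`)
  only to keep this vocabulary file out of the import closure of the `Cryptography` topic, which the
  machine-level files import anyway;
* the `δ`-distinguishing advantage of a test `D` between `DP_k(x; U_{nk})` and `U_{nk+k}` (§3.1,
  p. 20; the hypothesis of Thm. 3.12 for a deterministic test), `dpAdvantage`, with bounds and the
  one-sided lower bound used in Claim 8.11 (`le_dpAdvantage_of_le_of_le`);
* the input convention `dpEnumEnc a n k e = ⟨a, 1ⁿ, 1^{2^k}, 1ᵉ⟩` for the enumeration form of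
  Thm. 3.12 ("in time `poly(ns2^k/δ)`, given a description of the circuit `D`, one can enumerate a
  list of strings that contains `x`"), with `2^k` and `e = 1/δ` in unary so that this running time
  is polynomial in the input.

## Conventions

* Probabilities over `{0,1}^m` are the counting probabilities `uniformProb m` (`Randomized.lean`).
* `dpGen` is total in `z`; its intended domain is `|z| = |x|·k` (`k` blocks of length `|x|`).

Mathlib has no direct product generators or Hadamard-code vocabulary on bit strings; in the tree the
same functions exist as `Cryptography.ipBit` / `Cryptography.glBits` (see above for why they are
restated definitionally rather than imported).

## References

* S. Hirahara, *Average-case hardness of NP from exponential worst-case hardness assumptions*,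
  STOC 2021; full version ECCC TR21-058: §3.1 (p. 20, distinguishing), Def. 3.9, Def. 3.10,
  Thm. 3.12 and the remark following it (pp. 22–23); proof of Thm. 8.9, Claim 8.11 (pp. 41–42).
* O. Goldreich, L. A. Levin, *A hard-core predicate for all one-way functions*, STOC 1989 (the
  Hadamard code and its local list decoding, Lemma 3.11 of the paper).
-/

namespace Literature.Computability.MetaComplexity

open _root_.Computability Complexity

/-! ### Def. 3.9 / 3.10: the Hadamard code and the `k`-wise direct product generator -/

/-- **The Hadamard code** `Had(x)(z) := Σᵢ xᵢ zᵢ mod 2` (inner product of bit strings, zipped;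
surplus bits of the longer string are ignored). Definitionally the tree's Goldreich–Levin predicate
`Cryptography.ipBit x z`. [Hirahara 2021 (ECCC TR21-058), Def. 3.9; Goldreich–Levin 1989]
[cite: Hirahara2021, Def. 3.9] -/
def hadBit (x z : List Bool) : Bool :=
  (List.zipWith (· && ·) x z).foldr Bool.xor false

/-- **The `k`-wise direct product generator** `DP_k : {0,1}ⁿ × ({0,1}ⁿ)^k → {0,1}^{nk+k}`,
`DP_k(x; z₁, …, z_k) := (z₁, …, z_k, Had(x)(z₁), …, Had(x)(z_k))`, where `Had(x)(z) = Σᵢ xᵢzᵢ mod 2`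
is the Hadamard code `hadBit` (Def. 3.9) and `z = z₁ ⋯ z_k ∈ {0,1}^{nk}` is read in `k` blocks of
length `n = |x|` (block `j` is `(z.drop (j·n)).take n`); the code part is definitionally the tree's
`Cryptography.glBits k |x| x z`. (Defined for all `z`; intended for `|z| = |x|·k`.)
[Hirahara 2021 (ECCC TR21-058), Def. 3.9, Def. 3.10] [cite: Hirahara2021, Def. 3.10] -/
def dpGen (k : ℕ) (x z : List Bool) : List Bool :=
  z ++ (List.range k).map fun j => hadBit x ((z.drop (j * x.length)).take x.length)

/-- `DP_k(x; z)` has length `|z| + k` (so `nk + k` on its intended domain).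
[Hirahara 2021 (ECCC TR21-058), Def. 3.10] [cite: Hirahara2021, Def. 3.10] -/
@[simp] theorem length_dpGen (k : ℕ) (x z : List Bool) : (dpGen k x z).length = z.length + k := by
  simp [dpGen]

/-- The first `|z|` bits of `DP_k(x; z)` are the seed `z` itself (`DP_k` is "seed-extending").
[Hirahara 2021 (ECCC TR21-058), Def. 3.10] [cite: Hirahara2021, Def. 3.10] -/
@[simp] theorem take_length_dpGen (k : ℕ) (x z : List Bool) : (dpGen k x z).take z.length = z := by
  simp [dpGen]

/-- The last `k` bits of `DP_k(x; z)` are the Hadamard/Goldreich–Levin bits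
`Had(x)(z₁), …, Had(x)(z_k)`. [Hirahara 2021 (ECCC TR21-058), Def. 3.10] [cite: Hirahara2021, Def. 3.10] -/
@[simp] theorem drop_length_dpGen (k : ℕ) (x z : List Bool) :
    (dpGen k x z).drop z.length =
      (List.range k).map fun j => hadBit x ((z.drop (j * x.length)).take x.length) := by
  simp [dpGen]

/-- `DP_k(x; ·)` is injective on seeds of a fixed length (the seed is a prefix of the output).
[Hirahara 2021 (ECCC TR21-058), Def. 3.10] [cite: Hirahara2021, Def. 3.10] -/
theorem dpGen_injective_of_length_eq (k : ℕ) (x : List Bool) {z z' : List Bool}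
    (hlen : z.length = z'.length) (h : dpGen k x z = dpGen k x z') : z = z' := by
  have := congr_arg (fun l => l.take z.length) h
  simp only [take_length_dpGen] at this
  rw [this, hlen, take_length_dpGen]

/-! ### §3.1: distinguishing advantage against `DP_k` -/

/-- The **distinguishing advantage** of a test `D : {0,1}* → {0,1}` between the output distribution
`DP_k(x; z)`, `z ← {0,1}^{nk}`, and the uniform distribution `w ← {0,1}^{nk+k}` (`n = |x|`):
`|Pr_z[D(DP_k(x; z)) = 1] - Pr_w[D(w) = 1]|`; `D` "`δ`-distinguishes" iff this is `≥ δ` (§3.1,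
p. 20, and the hypothesis of Thm. 3.12 with a deterministic test). Probabilities are `uniformProb`.
[Hirahara 2021 (ECCC TR21-058), §3.1 (p. 20), Thm. 3.12] [cite: Hirahara2021, Thm. 3.12] -/
noncomputable def dpAdvantage (k : ℕ) (x : List Bool) (D : List Bool → Bool) : ℝ :=
  |uniformProb (x.length * k) {z | D (dpGen k x z) = true} -
    uniformProb (x.length * k + k) {w | D w = true}|

/-- The advantage is nonnegative. [Hirahara 2021 (ECCC TR21-058), §3.1] [folklore] -/
theorem dpAdvantage_nonneg (k : ℕ) (x : List Bool) (D : List Bool → Bool) : 0 ≤ dpAdvantage k x D :=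
  abs_nonneg _

/-- The advantage is at most `1` (both probabilities lie in `[0, 1]`).
[Hirahara 2021 (ECCC TR21-058), §3.1] [folklore] -/
theorem dpAdvantage_le_one (k : ℕ) (x : List Bool) (D : List Bool → Bool) : dpAdvantage k x D ≤ 1 := by
  unfold dpAdvantage
  have h1 := uniformProb_nonneg (x.length * k) {z | D (dpGen k x z) = true}
  have h2 := uniformProb_le_one (x.length * k) {z | D (dpGen k x z) = true}
  have h3 := uniformProb_nonneg (x.length * k + k) {w | D w = true}
  have h4 := uniformProb_le_one (x.length * k + k) {w | D w = true}
  rw [abs_le]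
  constructor <;> linarith

/-- A lower bound on the advantage without absolute values: if `D` accepts `DP_k(x; z)` with
probability `≥ q` and a uniform string with probability `≤ q - δ`, then `D` `δ`-distinguishes.
(The form used in Claim 8.11.) [Hirahara 2021 (ECCC TR21-058), §3.1, Claim 8.11] [folklore] -/
theorem le_dpAdvantage_of_le_of_le {k : ℕ} {x : List Bool} {D : List Bool → Bool} {q δ : ℝ}
    (h1 : q ≤ uniformProb (x.length * k) {z | D (dpGen k x z) = true})
    (h2 : uniformProb (x.length * k + k) {w | D w = true} ≤ q - δ) : δ ≤ dpAdvantage k x D := by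
  unfold dpAdvantage
  exact le_trans (by linarith) (le_abs_self _)

/-- The input encoding of the enumerator of Thm. 3.12: `⟨a, ⟨1ⁿ, ⟨1^{2^k}, 1ᵉ⟩⟩⟩` — the description
`a` of the test, the length `n` of the hidden string, the list-size parameter `2^k` and the inverse
advantage `e = 1/δ`, all but `a` in unary. [Hirahara 2021 (ECCC TR21-058), Thm. 3.12 (inputs
`(x, 1^k, 1^{δ⁻¹}, 1^s)` of `C^D`) and the remark following it] [cite: Hirahara2021, Thm. 3.12] -/
def dpEnumEnc (a : List Bool) (n k e : ℕ) : List Bool :=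
  boolPair a (boolPair (unaryEncodeNat n) (boolPair (unaryEncodeNat (2 ^ k)) (unaryEncodeNat e)))

end Literature.Computability.MetaComplexity
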